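import Summits.Ventures.HodgeRepro2.T7SupportCartanShift
import Summits.Ventures.HodgeRepro2.T7SupportBergmanOrbitalDecay

/-!
# The one-vector orbital integral decays like `κ(γ)^{−k/2}` in the Bergman model (support, seat p1)

The line's test function at the two rank-one archimedean places (L3-ARGUMENT §2g) is the ONE-vector coefficient
of the lowest-weight vector `u_A = 1` of the weight-`k` Bergman model: `f(g) = ⟨π_k(g) 1, 1⟩_k = a(g)^{−k} ⟨1, 1⟩_k`
(`matrixCoeff_lowest_lowest`, from `T5BergmanCoefficient.pairing_act_lowest`). Along the second-torus orbit
`γ h rot(w) h⁻¹` of `γ` the Cartan size stays within the shift constant `s(h) = |a(h)| + |b(h)|` of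
`|a(γ h)| = κ(γ)^{1/2}` (`T7SupportCartanShift`), so UNIFORMLY in `w`

  `‖⟨π_k(γ h rot(w) h⁻¹) 1, 1⟩_k‖ ≤ s(h)^k ‖⟨1, 1⟩_k‖ · κ(γ)^{−k/2}`   (`norm_matrixCoeff_lowest_conj_torus_le_kappa`),

hence the `q`-th Fourier coefficient `Φ_q(γ)` of `w ↦ ⟨π_k(γ h rot(w) h⁻¹) 1, 1⟩_k` (row 696's `fourierCoeff` in the
model, `lowestFourierCoeff`) and the full two-torus orbital integral
`∫_K ∫_K ⟨π_k(rot u · γ · h rot(w) h⁻¹) 1, 1⟩_k u^p conj(w^q) = [p = k] · Φ_q(γ)` (`torus_orbital_lowest_eq`) obey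

  `‖…‖ ≤ s(h)^k ‖⟨1, 1⟩_k‖ · κ(γ)^{−k/2}`   (`norm_lowestFourierCoeff_le_kappa`, `norm_torus_orbital_lowest_le_kappa`)

— the `a_bound` of the dominant-term argument for the line's one-vector `f`, with the SAME exponent `α = k/2` as the
two-vector coefficient of `T7SupportBergmanOrbitalDecay` (row 677) and the constant `s(h)^k ‖⟨1,1⟩_k‖` depending on
`h` only (crit-1 (r3): «the a_bound for the one-vector f at γ ≠ 1 = the sup over the compact torus of the
coefficient» — here that sup is bounded by the κ-decay).

Explicit model only; nothing about the adelic group, the global invariant, or any period.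
Blind lane: Mathlib + the HodgeRepro2 prefix only; no sorry; axioms ⊆ {propext, Classical.choice, Quot.sound}.
-/

namespace Summit.Ventures.HodgeRepro2.T7SupportBergmanOneVectorDecay

open MeasureTheory
open T5SU11Unimodular T5SU11Fibration T5BergmanCoefficient T5BergmanMatrixCoeff T5HaarCircle T5BergmanActStable
  T7SupportTwoTorusInvariant T7SupportKappaCartan T7SupportCartanShift T7SupportBergmanOrbitalDecay
  T7SupportBergmanTorusOrbital

/-- **the one-vector coefficient of the lowest-weight vector**: `⟨π_k(g) 1, 1⟩_k = a(g)^{−k} ⟨1, 1⟩_k` -/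
theorem matrixCoeff_lowest_lowest (k : ℕ) (g : SU11) :
    matrixCoeff k lowest lowest g = (mat g 0 0)⁻¹ ^ k * pairing k lowest lowest :=
  pairing_act_lowest k g

/-- `‖⟨π_k(g) 1, 1⟩_k‖ = |a(g)|^{−k} ‖⟨1, 1⟩_k‖` -/
theorem norm_matrixCoeff_lowest_lowest (k : ℕ) (g : SU11) :
    ‖matrixCoeff k lowest lowest g‖ = ‖mat g 0 0‖⁻¹ ^ k * ‖pairing k lowest lowest‖ :=
  norm_pairing_act_lowest k g

/-- **uniformly along the second-torus orbit**: `‖⟨π_k(γ h rot(w) h⁻¹) 1, 1⟩_k‖ ≤ s(h)^k |a(γ h)|^{−k} ‖⟨1, 1⟩_k‖` -/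
theorem norm_matrixCoeff_lowest_conj_torus_le (k : ℕ) (γ h : SU11) (w : Circle) :
    ‖matrixCoeff k lowest lowest (γ * (h * rot w * h⁻¹))‖ ≤
      shiftConst h ^ k * ‖mat (γ * h) 0 0‖⁻¹ ^ k * ‖pairing k lowest lowest‖ := by
  rw [norm_matrixCoeff_lowest_lowest]
  have h1 := inv_norm_mat_conj_torus_zero_zero_le γ h w
  have h2 : ‖mat (γ * (h * rot w * h⁻¹)) 0 0‖⁻¹ ^ k ≤ (shiftConst h * ‖mat (γ * h) 0 0‖⁻¹) ^ k :=
    pow_le_pow_left₀ (inv_nonneg.2 (norm_nonneg _)) h1 k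
  rw [mul_pow] at h2
  exact mul_le_mul_of_nonneg_right h2 (norm_nonneg _)

/-- the same bound in the invariant: `≤ s(h)^k ‖⟨1, 1⟩_k‖ · κ(γ)^{−k/2}` -/
theorem norm_matrixCoeff_lowest_conj_torus_le_kappa (k : ℕ) (γ h : SU11) (w : Circle) :
    ‖matrixCoeff k lowest lowest (γ * (h * rot w * h⁻¹))‖ ≤
      shiftConst h ^ k * ‖pairing k lowest lowest‖ *
        (kappa (starRingEnd ℂ) dd (colBasis h) (mat γ)).re ^ (-(k : ℝ) / 2) := by
  have hc := norm_matrixCoeff_lowest_conj_torus_le k γ h w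
  rw [inv_pow_eq_normSq_rpow (mat_zero_zero_ne_zero (γ * h)) k] at hc
  rw [kappa_eq_normSq, Complex.ofReal_re]
  calc ‖matrixCoeff k lowest lowest (γ * (h * rot w * h⁻¹))‖
      ≤ shiftConst h ^ k * Complex.normSq (mat (γ * h) 0 0) ^ (-(k : ℝ) / 2) * ‖pairing k lowest lowest‖ := hc
    _ = shiftConst h ^ k * ‖pairing k lowest lowest‖ * Complex.normSq (mat (γ * h) 0 0) ^ (-(k : ℝ) / 2) := by
        ring

/-- `a(rot u · g) = u · a(g)` -/
theorem mat_rot_mul_zero_zero (u : Circle) (g : SU11) : mat (rot u * g) 0 0 = (u : ℂ) * mat g 0 0 := by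
  rw [mat_mul_zero_zero, mat_rot]
  simp [T5PoincareDensity.su11]

/-- the first torus: `⟨π_k(rot u · g) 1, 1⟩_k = u^{−k} ⟨π_k(g) 1, 1⟩_k` (the lowest-weight vector has `K`-type `k`) -/
theorem matrixCoeff_lowest_rot_mul (k : ℕ) (u : Circle) (g : SU11) :
    matrixCoeff k lowest lowest (rot u * g) = ((u : ℂ)⁻¹) ^ k * matrixCoeff k lowest lowest g := by
  rw [matrixCoeff_lowest_lowest, matrixCoeff_lowest_lowest, mat_rot_mul_zero_zero, mul_inv, mul_pow]
  ring

variable [MeasurableSpace Circle] [BorelSpace Circle]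

/-- **the `q`-th Fourier coefficient of the one-vector coefficient along the second torus** (row 696's
`fourierCoeff` in the model): `Φ_q(γ) = ∫_K conj(w^q) ⟨π_k(γ h rot(w) h⁻¹) 1, 1⟩_k dw` -/
noncomputable def lowestFourierCoeff (k : ℕ) (h : SU11) (q : ℤ) (γ : SU11) : ℂ :=
  ∫ w : Circle, (starRingEnd ℂ) ((w : ℂ) ^ q) * matrixCoeff k lowest lowest (γ * (h * rot w * h⁻¹)) ∂haarCircle

/-- a uniform bound of the coefficient along the orbit bounds the Fourier coefficient (probability measure) -/
theorem norm_lowestFourierCoeff_le_of_forall (k : ℕ) (h : SU11) (q : ℤ) (γ : SU11) {C : ℝ}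
    (hC : ∀ w : Circle, ‖matrixCoeff k lowest lowest (γ * (h * rot w * h⁻¹))‖ ≤ C) :
    ‖lowestFourierCoeff k h q γ‖ ≤ C := by
  unfold lowestFourierCoeff
  have hb : ∀ w : Circle,
      ‖(starRingEnd ℂ) ((w : ℂ) ^ q) * matrixCoeff k lowest lowest (γ * (h * rot w * h⁻¹))‖ ≤ C := by
    intro w
    rw [norm_mul, Complex.norm_conj, norm_zpow, Circle.norm_coe, one_zpow, one_mul]
    exact hC w
  calc ‖∫ w : Circle, (starRingEnd ℂ) ((w : ℂ) ^ q) * matrixCoeff k lowest lowest (γ * (h * rot w * h⁻¹))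
          ∂haarCircle‖
      ≤ C * (haarCircle : Measure Circle).real Set.univ :=
        norm_integral_le_of_norm_le_const (Filter.Eventually.of_forall hb)
    _ = C := by rw [probReal_univ, mul_one]

/-- **`‖Φ_q(γ)‖ ≤ s(h)^k ‖⟨1, 1⟩_k‖ · κ(γ)^{−k/2}`** -/
theorem norm_lowestFourierCoeff_le_kappa (k : ℕ) (h : SU11) (q : ℤ) (γ : SU11) :
    ‖lowestFourierCoeff k h q γ‖ ≤
      shiftConst h ^ k * ‖pairing k lowest lowest‖ *
        (kappa (starRingEnd ℂ) dd (colBasis h) (mat γ)).re ^ (-(k : ℝ) / 2) :=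
  norm_lowestFourierCoeff_le_of_forall k h q γ (fun w => norm_matrixCoeff_lowest_conj_torus_le_kappa k γ h w)

omit [BorelSpace Circle] in
/-- the inner integral over the second torus -/
theorem inner_integral_lowest (k : ℕ) (h : SU11) (u : Circle) (γ : SU11) (p q : ℤ) :
    ∫ w : Circle, matrixCoeff k lowest lowest (rot u * γ * (h * rot w * h⁻¹)) *
        ((u : ℂ) ^ p * (starRingEnd ℂ) ((w : ℂ) ^ q)) ∂haarCircle =
      (u : ℂ) ^ (p - (k : ℤ)) * lowestFourierCoeff k h q γ := by
  have e : ∀ w : Circle,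
      matrixCoeff k lowest lowest (rot u * γ * (h * rot w * h⁻¹)) * ((u : ℂ) ^ p * (starRingEnd ℂ) ((w : ℂ) ^ q)) =
      (u : ℂ) ^ (p - (k : ℤ)) *
        ((starRingEnd ℂ) ((w : ℂ) ^ q) * matrixCoeff k lowest lowest (γ * (h * rot w * h⁻¹))) := by
    intro w
    rw [mul_assoc (rot u) γ, matrixCoeff_lowest_rot_mul, ← inv_pow_mul_zpow u k p]
    ring
  simp_rw [e]
  rw [integral_const_mul]
  rfl

/-- **the two-torus orbital integral of the one-vector coefficient in the model**:
`∫∫ ⟨π_k(rot u · γ · h rot(w) h⁻¹) 1, 1⟩_k u^p conj(w^q) = [p = k] · Φ_q(γ)` -/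
theorem torus_orbital_lowest_eq (k : ℕ) (h γ : SU11) (p q : ℤ) :
    ∫ u : Circle, ∫ w : Circle, matrixCoeff k lowest lowest (rot u * γ * (h * rot w * h⁻¹)) *
        ((u : ℂ) ^ p * (starRingEnd ℂ) ((w : ℂ) ^ q)) ∂haarCircle ∂haarCircle =
      (if p = (k : ℤ) then 1 else 0) * lowestFourierCoeff k h q γ := by
  simp_rw [inner_integral_lowest k h _ γ p q]
  have e : ∀ u : Circle, (u : ℂ) ^ (p - (k : ℤ)) * lowestFourierCoeff k h q γ =
      lowestFourierCoeff k h q γ * ((u : ℂ) ^ (p - (k : ℤ)) * (starRingEnd ℂ) ((u : ℂ) ^ (0 : ℤ))) := by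
    intro u
    simp only [zpow_zero, map_one, mul_one]
    ring
  simp_rw [e]
  rw [integral_const_mul, integral_zpow_mul_conj_zpow]
  simp only [sub_eq_zero]
  ring

/-- **the orbital integral decays like `κ(γ)^{−k/2}`** — the `a_bound` for the line's one-vector `f` -/
theorem norm_torus_orbital_lowest_le_kappa (k : ℕ) (h γ : SU11) (p q : ℤ) :
    ‖∫ u : Circle, ∫ w : Circle, matrixCoeff k lowest lowest (rot u * γ * (h * rot w * h⁻¹)) *
        ((u : ℂ) ^ p * (starRingEnd ℂ) ((w : ℂ) ^ q)) ∂haarCircle ∂haarCircle‖ ≤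
      shiftConst h ^ k * ‖pairing k lowest lowest‖ *
        (kappa (starRingEnd ℂ) dd (colBasis h) (mat γ)).re ^ (-(k : ℝ) / 2) := by
  rw [torus_orbital_lowest_eq, norm_mul]
  have h1 : ‖(if p = (k : ℤ) then (1 : ℂ) else 0)‖ ≤ 1 := by
    split_ifs <;> simp
  calc ‖(if p = (k : ℤ) then (1 : ℂ) else 0)‖ * ‖lowestFourierCoeff k h q γ‖
      ≤ 1 * (shiftConst h ^ k * ‖pairing k lowest lowest‖ *
          (kappa (starRingEnd ℂ) dd (colBasis h) (mat γ)).re ^ (-(k : ℝ) / 2)) := by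
        gcongr
        exact norm_lowestFourierCoeff_le_kappa k h q γ
    _ = _ := one_mul _

end Summit.Ventures.HodgeRepro2.T7SupportBergmanOneVectorDecay
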